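import Summits.BirchSwinnertonDyer.Rank1Residual.X11b.IntSeriesValueRigidity
import Summits.BirchSwinnertonDyer.Rank1Residual.X11b.BDPRouteHsiehFrame
import Mathlib.RingTheory.PowerSeries.Substitution
import HarnessLib

/-!
# X11b · S29 K2a-1: COMPOSITION of `𝓞_{ℂ_p}⟦T⟧`-series with a series without constant term, and
# its EVALUATION law on the open unit disc (every prime `p`; theorems only)

HONEST FRAMING (cell `b2b-bsdres`, run/shared/lean/b2b/bsd-rank1-residual/, verbatim in every
file): the goal of the cell is to DELETE the COMBINATION-SHAPED residual classes of the
Birch–Swinnerton-Dyer formula for ALL analytic-rank `≤ 1` elliptic curves over `ℚ` — assembled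
STRICTLY from published theorems — so that the rank-`≤ 1` remainder becomes exactly the
CONSTRUCTION-SHAPED classes, which are TYPED, NOT attempted. This is not "finishing BSD". Team
`x11b3` = N8/O2 (X11b at `p = 3`): research routes; nothing booked; no label change; O2 OPEN; the
node of record `Three.HsiehDescentAt₃` is UNCHANGED by this file (sub-target S29 RE-EXPRESSES (t)
⟸ (VR); lead GEN 8 R9-8 / R9-10).

PROVENANCE: S29 (x11b3-p7's "(n2)-by-values road", `HOME/b2b-bsdres-x11b3-p7/s25/S29-SIGMA-VALUES-ROAD.md`),
kernel package K2 (R) 'rigidity', formal half K2a, seat `b2b-bsdres-x11b3-p3` GEN 7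
(`HOME/b2b-bsdres-x11b3-p3/gen7/K2-INTERFACE-DRAFT.md`). This file is the COMPOSITION layer the
squaring device `χ ↦ χ²` needs: the point of `χ^m` is `[m](y) := (1 + y)^m − 1` where `y` is the
point of `χ`, so "`Q` at the point of `χ^m`" is "`Q ∘ [m]` at the point of `χ`".

## What is proved (currency `IntSeries.HasValueAt` of `AnticyclotomicRankinSelbergPAdicLFunction`,
## `Q : PowerSeries 𝓞_ℂ_[p]`; composition = Mathlib's `PowerSeries.subst`, NO new definition)

* `intSeries_hasValueAt_add/sub/one/X`, `intSeries_hasValueAt_pow` (`b` at `x` is `y` ⇒ `b^d`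
  at `x` is `y^d`), `coeff_pow_eq_zero_of_lt` (`b(0) = 0 ⇒ [T^n] b^d = 0` for `n < d`); scalar
  multiples are the tree's `intSeries_hasValueAt_C_mul` (`X11b/BDPRouteHsiehFrame.lean`, imported);
* **`intSeries_hasValueAt_subst`** — the EVALUATION LAW: `b(0) = 0`, `‖x‖ < 1`, `b` at `x` is `y`,
  `Q` at `y` is `v` ⟹ `Q.subst b` at `x` is `v` (absolutely convergent double sum over
  `{(d,n) : d ≤ n}`, bound `‖x‖^n`, Mathlib `HasSum.prod_fiberwise` twice);
* the power maps: `constantCoeff_powMap` / `hasSubst_powMap` for `[m] = (1 + X)^m − 1`,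
  `intSeries_hasValueAt_powMap` (`[m]` at `x` is `(1+x)^m − 1`), and the specialisation
  **`intSeries_hasValueAt_subst_powMap`**.

References: [Castella2018] §2.2; [Cassels1986] Ch. 4 Lemma 2.1; Mathlib `RingTheory/PowerSeries/Substitution`.
-/

noncomputable section

open scoped Classical Topology
open Filter PowerSeries Literature.NumberTheory.EllipticCurves

namespace Summit.BirchSwinnertonDyer.Rank1Residual.X11b

variable {p : ℕ} [Fact p.Prime]

/-! ### §1 Linear algebra of values; powers -/

/-- Values add. [folklore] -/
theorem intSeries_hasValueAt_add {Q R : PowerSeries 𝓞_ℂ_[p]} {x v w : ℂ_[p]}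
    (hQ : IntSeries.HasValueAt Q x v) (hR : IntSeries.HasValueAt R x w) :
    IntSeries.HasValueAt (Q + R) x (v + w) := by
  unfold IntSeries.HasValueAt at *
  simpa [add_mul] using hQ.add hR

/-- Values subtract. [folklore] -/
theorem intSeries_hasValueAt_sub {Q R : PowerSeries 𝓞_ℂ_[p]} {x v w : ℂ_[p]}
    (hQ : IntSeries.HasValueAt Q x v) (hR : IntSeries.HasValueAt R x w) :
    IntSeries.HasValueAt (Q - R) x (v - w) := by
  unfold IntSeries.HasValueAt at *
  simpa [sub_mul] using hQ.sub hR

/-- The value of `1` is `1`. [folklore] -/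
theorem intSeries_hasValueAt_one (x : ℂ_[p]) :
    IntSeries.HasValueAt (1 : PowerSeries 𝓞_ℂ_[p]) x 1 := by
  simpa using intSeries_hasValueAt_X_pow (p := p) 0 x

/-- The value of `X` at `x` is `x`. [folklore] -/
theorem intSeries_hasValueAt_X (x : ℂ_[p]) :
    IntSeries.HasValueAt (X : PowerSeries 𝓞_ℂ_[p]) x x := by
  simpa using intSeries_hasValueAt_X_pow (p := p) 1 x

/-- **Powers**: if `b` has value `y` at `x` (`‖x‖ < 1`) then `b^d` has value `y^d`. [folklore] -/
theorem intSeries_hasValueAt_pow {b : PowerSeries 𝓞_ℂ_[p]} {x y : ℂ_[p]} (hx : ‖x‖ < 1)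
    (hb : IntSeries.HasValueAt b x y) (d : ℕ) : IntSeries.HasValueAt (b ^ d) x (y ^ d) := by
  induction d with
  | zero => simpa using intSeries_hasValueAt_one (p := p) x
  | succ d ih =>
    rw [pow_succ, pow_succ]
    exact intSeries_hasValueAt_mul hx ih hb

/-- If `b(0) = 0` then `[T^n] b^d = 0` for `n < d` (`X^d ∣ b^d`). [folklore] -/
theorem coeff_pow_eq_zero_of_lt {R : Type*} [CommRing R] {b : PowerSeries R}
    (hb : constantCoeff b = 0) {d n : ℕ} (hn : n < d) : coeff n (b ^ d) = 0 :=
  coeff_of_lt_order n (lt_of_lt_of_le (by exact_mod_cast hn)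
    (le_order_pow_of_constantCoeff_eq_zero d hb))

/-! ### §2 The evaluation law for `PowerSeries.subst` -/

/-- **EVALUATION LAW for composition.** Let `b ∈ 𝓞_{ℂ_p}⟦T⟧` with `b(0) = 0` have value `y` at a
point `x` of the open unit disc, and let `Q` have value `v` at `y`. Then the composite
`Q.subst b = Σ_d [T^d]Q · b^d` (Mathlib `PowerSeries.subst`) has value `v` at `x`. Proof: the double
family `(d, n) ↦ [T^d]Q · [T^n](b^d) · x^n` is supported on `d ≤ n` and bounded by `‖x‖^n` there, hence
summable; summing over `n` first gives `Σ_d [T^d]Q · y^d = v`, over `d` first gives the value series of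
`Q.subst b` (`coeff_subst'`). [cite: Cassels1986, Ch. 4 Lemma 2.1] -/
theorem intSeries_hasValueAt_subst {Q b : PowerSeries 𝓞_ℂ_[p]} (hb0 : constantCoeff b = 0)
    {x y v : ℂ_[p]} (hx : ‖x‖ < 1) (hy : IntSeries.HasValueAt b x y)
    (hv : IntSeries.HasValueAt Q y v) :
    IntSeries.HasValueAt (Q.subst b) x v := by
  have hbs : HasSubst b := HasSubst.of_constantCoeff_zero' hb0
  -- the double family
  set F : ℕ × ℕ → ℂ_[p] := fun q =>
    ((coeff q.1 Q : 𝓞_ℂ_[p]) : ℂ_[p]) * (((coeff q.2 (b ^ q.1) : 𝓞_ℂ_[p]) : ℂ_[p]) * x ^ q.2)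
    with hF
  -- (a) summability: on the support `d ≤ n`, `‖F (d,n)‖ ≤ ‖x‖^n ≤ s^d · s^n` with `s = √‖x‖ < 1`
  set s : ℝ := Real.sqrt ‖x‖ with hs
  have hs0 : 0 ≤ s := Real.sqrt_nonneg _
  have hs1 : s < 1 := by
    rw [hs, Real.sqrt_lt' one_pos, one_pow]
    exact hx
  have hss : s * s = ‖x‖ := Real.mul_self_sqrt (norm_nonneg x)
  set g : ℕ × ℕ → ℝ := fun q => s ^ q.1 * s ^ q.2 with hg
  have hF_le : ∀ q, ‖F q‖ ≤ g q := by
    rintro ⟨d, n⟩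
    by_cases hdn : d ≤ n
    · have hxn : ‖x‖ ^ n ≤ s ^ d * s ^ n := by
        rw [← hss, mul_pow]
        exact mul_le_mul_of_nonneg_right (pow_le_pow_of_le_one hs0 hs1.le hdn) (pow_nonneg hs0 _)
      calc ‖F (d, n)‖ = ‖((coeff d Q : 𝓞_ℂ_[p]) : ℂ_[p])‖ *
            (‖((coeff n (b ^ d) : 𝓞_ℂ_[p]) : ℂ_[p])‖ * ‖x‖ ^ n) := by
            simp only [hF, norm_mul, norm_pow]
        _ ≤ 1 * (1 * ‖x‖ ^ n) := by
            gcongr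
            · exact R1.norm_coe_padicComplexInt_le_one p _
            · exact R1.norm_coe_padicComplexInt_le_one p _
        _ = ‖x‖ ^ n := by ring
        _ ≤ g (d, n) := hxn
    · have : coeff n (b ^ d) = 0 := coeff_pow_eq_zero_of_lt hb0 (Nat.lt_of_not_le hdn)
      have h0 : F (d, n) = 0 := by simp [hF, this]
      rw [h0, norm_zero]
      exact mul_nonneg (pow_nonneg hs0 _) (pow_nonneg hs0 _)
  have hg_summable : Summable g :=
    (summable_geometric_of_lt_one hs0 hs1).mul_of_nonneg (summable_geometric_of_lt_one hs0 hs1)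
      (fun _ => pow_nonneg hs0 _) (fun _ => pow_nonneg hs0 _)
  have hF_summable : Summable F := Summable.of_norm_bounded hg_summable hF_le
  obtain ⟨A, hA⟩ := hF_summable
  -- (b) the `d`-fibers: `Σ_n F(d,n) = [T^d]Q · y^d`, hence `A = v`
  have hfib_d : ∀ d : ℕ, HasSum (fun n => F (d, n)) (((coeff d Q : 𝓞_ℂ_[p]) : ℂ_[p]) * y ^ d) := by
    intro d
    have h := (intSeries_hasValueAt_pow hx hy d).mul_left ((coeff d Q : 𝓞_ℂ_[p]) : ℂ_[p])
    simpa only [hF, IntSeries.HasValueAt] using h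
  have hAv : A = v := by
    have h1 : HasSum (fun d => ((coeff d Q : 𝓞_ℂ_[p]) : ℂ_[p]) * y ^ d) A := hA.prod_fiberwise hfib_d
    exact h1.unique hv
  -- (c) the `n`-fibers: `Σ_d F(d,n) = [T^n](Q.subst b) · x^n`
  have hA' : HasSum (fun q : ℕ × ℕ => F q.swap) A := by
    rw [← (Equiv.prodComm ℕ ℕ).hasSum_iff] at hA
    exact hA
  have hfib_n : ∀ n : ℕ, HasSum (fun d => F (d, n))
      (((coeff n (Q.subst b) : 𝓞_ℂ_[p]) : ℂ_[p]) * x ^ n) := by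
    intro n
    have hzero : ∀ d ∉ Finset.range (n + 1), F (d, n) = 0 := by
      intro d hd
      rw [Finset.mem_range, not_lt] at hd
      have : coeff n (b ^ d) = 0 := coeff_pow_eq_zero_of_lt hb0 (Nat.lt_of_succ_le hd)
      simp [hF, this]
    have hsum : HasSum (fun d => F (d, n)) (∑ d ∈ Finset.range (n + 1), F (d, n)) :=
      hasSum_sum_of_ne_finset_zero hzero
    have hcoeff : coeff n (Q.subst b) = ∑ d ∈ Finset.range (n + 1), coeff d Q * coeff n (b ^ d) := by
      rw [coeff_subst' hbs Q n, finsum_eq_sum_of_support_subset _ (s := Finset.range (n + 1))]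
      · simp only [smul_eq_mul]
      · intro d hd
        rw [Function.mem_support] at hd
        by_contra h
        rw [Finset.mem_coe, Finset.mem_range, not_lt] at h
        exact hd (by rw [coeff_pow_eq_zero_of_lt hb0 (Nat.lt_of_succ_le h), smul_zero])
    have heq : ∑ d ∈ Finset.range (n + 1), F (d, n) =
        ((coeff n (Q.subst b) : 𝓞_ℂ_[p]) : ℂ_[p]) * x ^ n := by
      rw [hcoeff]
      push_cast
      rw [Finset.sum_mul]
      refine Finset.sum_congr rfl fun d _ => ?_
      simp only [hF]
      ring
    rwa [heq] at hsum
  have h2 : HasSum (fun n => ((coeff n (Q.subst b) : 𝓞_ℂ_[p]) : ℂ_[p]) * x ^ n) A :=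
    hA'.prod_fiberwise fun n => by simpa using hfib_n n
  unfold IntSeries.HasValueAt
  rwa [hAv] at h2

/-! ### §3 The power maps `[m] = (1 + X)^m − 1` -/

/-- `[m](0) = 0`. [folklore] -/
theorem constantCoeff_powMap (m : ℕ) :
    constantCoeff (((1 + X : PowerSeries 𝓞_ℂ_[p]) ^ m) - 1) = 0 := by
  simp

/-- `[m]` can be substituted (`HasSubst`). [folklore] -/
theorem hasSubst_powMap (m : ℕ) :
    HasSubst (((1 + X : PowerSeries 𝓞_ℂ_[p]) ^ m) - 1) :=
  HasSubst.of_constantCoeff_zero' (constantCoeff_powMap m)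

/-- The value of `[m]` at `x` is `(1 + x)^m − 1`. [folklore] -/
theorem intSeries_hasValueAt_powMap (m : ℕ) {x : ℂ_[p]} (hx : ‖x‖ < 1) :
    IntSeries.HasValueAt (((1 + X : PowerSeries 𝓞_ℂ_[p]) ^ m) - 1) x ((1 + x) ^ m - 1) := by
  have h1 : IntSeries.HasValueAt (1 + X : PowerSeries 𝓞_ℂ_[p]) x (1 + x) :=
    intSeries_hasValueAt_add (intSeries_hasValueAt_one x) (intSeries_hasValueAt_X x)
  exact intSeries_hasValueAt_sub (intSeries_hasValueAt_pow hx h1 m) (intSeries_hasValueAt_one x)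

/-- **The evaluation law for `Q ∘ [m]`**: if `Q` has value `v` at `(1 + x)^m − 1` (the point of `χ^m`
when `x` is the point of `χ`), then `Q.subst [m]` has value `v` at `x`. [cite: Castella2018, §2.2] -/
theorem intSeries_hasValueAt_subst_powMap {Q : PowerSeries 𝓞_ℂ_[p]} (m : ℕ) {x v : ℂ_[p]}
    (hx : ‖x‖ < 1) (hv : IntSeries.HasValueAt Q ((1 + x) ^ m - 1) v) :
    IntSeries.HasValueAt (Q.subst (((1 + X : PowerSeries 𝓞_ℂ_[p]) ^ m) - 1)) x v :=
  intSeries_hasValueAt_subst (constantCoeff_powMap m) hx (intSeries_hasValueAt_powMap m hx) hv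

/-- `[2](x) = (1 + x)² − 1 = x·(x + 2)` (the normal form used by S27's abstract core). [folklore] -/
theorem one_add_sq_sub_one (x : ℂ_[p]) : (1 + x) ^ 2 - 1 = x * (x + 2) := by ring

/-- A point of the open unit disc has `[m]`-image in the open unit disc: `‖(1+x)^m − 1‖ < 1`
(ultrametric). [folklore] -/
theorem norm_one_add_pow_sub_one_lt {x : ℂ_[p]} (hx : ‖x‖ < 1) (m : ℕ) : ‖(1 + x) ^ m - 1‖ < 1 := by
  induction m with
  | zero => simp
  | succ m ih =>
    have : (1 + x) ^ (m + 1) - 1 = ((1 + x) ^ m - 1) + x * (1 + x) ^ m := by ring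
    rw [this]
    refine lt_of_le_of_lt (IsUltrametricDist.norm_add_le_max _ _) (max_lt ih ?_)
    rw [norm_mul, norm_pow]
    have h1 : ‖1 + x‖ ≤ 1 := by
      refine (IsUltrametricDist.norm_add_le_max _ _).trans (max_le (by simp) hx.le)
    calc ‖x‖ * ‖1 + x‖ ^ m ≤ ‖x‖ * 1 := by
          gcongr
          exact pow_le_one₀ (norm_nonneg _) h1
      _ < 1 := by rwa [mul_one]

end Summit.BirchSwinnertonDyer.Rank1Residual.X11b
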